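import Mathlib
import Literature.NumberTheory.LFunctions.Zhang2022.SkeletonPartThree
import Literature.NumberTheory.LFunctions.Zhang2022.Section14MeanSquareMajorant
import Literature.NumberTheory.LFunctions.Zhang2022.TypedSection15A
import Literature.NumberTheory.LFunctions.Zhang2022.TypedSection15B
import Literature.NumberTheory.LFunctions.Zhang2022.TypedSection15C
import Literature.NumberTheory.LFunctions.Zhang2022.TypedSection16A
import Literature.NumberTheory.LFunctions.Zhang2022.TypedSection16B
import Literature.NumberTheory.LFunctions.Zhang2022.TypedAppendixA1Identities
import Literature.NumberTheory.LFunctions.Zhang2022.AppendixALemma161Typed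
import HarnessLib

/-!
# Zhang (2022), typed manuscript — Appendix A, part 2: the proofs of Lemmas 15.2, 15.3, 16.1, 16.2
# (tex L5118–L5236, PDF pp. 103–106; DAG nodes `Z22:Lem15.2.pf` … `Z22:§A.u042`)

Topic `Literature/NumberTheory/LFunctions/Zhang2022` (Landau–Siegel audit tree; verdict-neutral).
Y. Zhang, *Discrete mean estimates and the Landau–Siegel zero*, arXiv:2211.02515v1 (2022)
[Zhang2022LandauSiegel] — **an unrefereed manuscript under adjudication. Every `def … : Prop`
below is a CLAIM OF THE MANUSCRIPT (or the manuscript's DEDUCTION of a statement from the displays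
it cites), STATED NOT ASSERTED; nothing here asserts or denies Theorems 1–2.** Cell siegel-zhang,
D-0069 width campaign, layer L4, slice L4-t9 (`plan/L4/ASSIGNMENTS.md` v2 row t9 = `plan/FILES.tsv`
`TypedAppendixA2.lean`): the second half of Appendix A "Some Euler products", i.e. the printed proofs
of Lemma 15.2 (with (A.6), (A.7)), Lemma 15.3 ("a sketch only"), Lemma 16.1 and Lemma 16.2 ("a
sketch only"). These displays REFINE the coarse skeleton deduction nodes `Skeleton.Ded1524` (§15 +
App. A ⇒ (15.24)) and `Skeleton.Ded1617` (§16 + App. A ⇒ (16.17)), inside which Lemmas 15.2–15.3 and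
16.1–16.2 are folded (`SkeletonPartThree`).

## How the objects of §§15–16 enter this file (L4 NAMING v1; MERGED — revisions 3–4)

The displays typed here speak about objects that §15, §16 and the first page of Appendix A
introduce. Revision 1 (p412356) carried them as local stubs; revision 2 (p413317) renamed those stubs
to the layer's binding names (STATUS «IFACE RULING» 23:30Z = L4 NAMING v1, owners' bodies verbatim);
revision 3 (p414212) is the MERGE announced in the cell's plan: the owners' files are ACCEPTED, so
the stubs are DELETED and the objects are IMPORTED — by `open … (names)` aliases, so that every claim
and theorem below is textually unchanged; revision 4 (this file) completes it for the STATEMENTS of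
Lemmas 15.2–15.3 (L4-t3's instance `Typed.Section15C.inputs15AB`, p413866) and adds the proved
edges from L4-t8's (A.4)/(A.5):

* from `Typed.Section15A` (L4-t1, p412590): `kappa1` (= the tree's `MeanSquareMajorant.kappa₁ (b₁) (b₂)`,
  §15 p. 81), `kappaTilde1` (15.9), `lam1` (15.10);
* from `Typed.Section15B` (L4-t2, p412274): `xi1` (15.13), `lamTilde1`, `xi1LocalSeries`, `calM1Factor`,
  `calM1` (`ℳ₁(d,l;s)` DEFINED as the Euler product over all primes of its printed local factor = the
  manuscript's analytic continuation to `σ > 9/10`, NAMING v1 (d)), `varpi1` (15.19);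
* from `Typed.Section15C` (L4-t3, p412250 + p413866): `eulerM1`, `eulerU1` (the Euler products of
  Lemmas 15.2/15.3), the series `calU1` (`𝒰₁ⱼ`, u052) and `IsCalU1` (its continuation to `σ ≥ 9/10`)
  at t3's instance `inputs15AB` (`X.calM1 := Section15B.calM1`, `X.varpi1 := Section15B.varpi1`, by
  `rfl`: `Section15C.inputs15AB_calM1/_varpi1`), and the STATEMENTS `Lemma152I`, `Lemma153I`
  (= `Lemma152/Lemma153 c' inputs15AB`, nodes Z22:Lem15.2, Z22:Lem15.3; `Step15_u053 c' inputs15AB`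
  is the second half of `Lemma153I`), which `Lem152_pf`, `Lem153_pf` below now target directly —
  revision 4; revisions 1–3 carried local copies with the same bodies, see `lemma152I_iff`,
  `lemma153I_iff` (`Iff.rfl`);
* from `Typed.Section16A` (L4-t4, p412610): `kappa2` (= the tree's `MeanSquareMajorant.kappa₂ (b₁)`),
  `kappaTilde2`, `lam2`, `xi2` (16.7), `lamTilde2` (16.8), `xi2LocalSeries`, `calM2Factor`, `calM2`,
  `calM2star` (`𝔪₂*`);
* from `Typed.Section16B` (L4-t5, p412297 + merge revision p413405): `frakpFactor`, `frakpA`, `frakpB`,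
  `frakp` (𝔭 of Lemma 16.1), `nuConvChi` (ν∗χ), `varpi2` (16.13), `frakU2Series`, `frakU2Main` (𝔲₂ⱼ,
  Lemma 16.2), and the STATEMENTS `Lemma161`, `Lemma162` (nodes Z22:Lem16.1, Z22:Lem16.2), which the
  deduction nodes `Lem161_pf`, `Lem162_pf` below now target directly.

LOCAL READINGS kept in this file: `EqA4`, `EqA5` = (A.4), (A.5) in the form the proof of Lemma 15.2
consumes them — (A.4) for the continued Euler product `Section15B.calM1` itself, (A.5) as one
`if … then … else` identity. The node declarations of record are L4-t8's `Typed.AppendixA1.EqA_4`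
((A.4) for ANY analytic continuation `M` of the printed series `calM1Series` to `σ > 9/10`) and
`Typed.AppendixA1.EqA_5`; Part 7 PROVES the edges `eqA4_of_eqA_4` (with §15.u034: `calM1` IS such a
continuation — `Section15B.Step15_u034`, `Step15_u034an`) and `eqA5_of_eqA_5`.
PROVIDED by this slice: the Euler factor `frakU1Factor` = `𝔲_{1j}(q,s)` (p. 105), `Pi2` = `Π₂(l)` (p. 106,
with its three defining clauses unfolded as `rfl`-level theorems), and the abbreviations of printed
sub-expressions `zetaFactor1` (the `ζ`-quotient of (A.4)/u021), `sumA6` (the `r`-sum of (A.6)),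
`zetaFactor2` (the `ζ`-quotient of u037).

Shapes (skel/INTERFACE.md §3): "`X = Y + O(R)`" ↦ `∃ C, ForAllLarge (… (A) → ‖X − Y‖ ≤ C·R)` with
the printed rate `R` verbatim (`α₁`, undefined in v1, read as `α𝓛` as in the skeleton); per-`q` /
per-`(d,l)` statements quantify over those variables with the printed side conditions as
hypotheses; EXACT identities ("for any `q`, `d`, `l` and `r`", "it is direct to verify that") are
typed as plain universally quantified equalities (stronger than the eventual shape). The shorthand
`u = q⁻¹`, `v = χ(q)` of Appendix A (p. 101) is spelled out. A display with several claims is one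
`def` = the conjunction of named parts. Where a display carries no range for the prime `q` but the
surrounding proof does, the range used is stated in the docstring (never silently added: see
`StepA_u035`–`StepA_u037`). Misprints are typed as read and flagged (`StepA_u025`: printed `−−`).
The four PROOF-BLOCK nodes are typed as implications (cited displays → lemma), closed terms. Part 6
PROVES the exact identity leaves of the proof of Lemma 15.2 (u021 first relation, u022, u024 first and
last equalities, u028, u029) from the definitions (`κ₁ = n^{−β₁} ∗ n^{−β₂} ∗ μ` at prime powers, `𝔫(q^r) =
𝔫(q) = {q^k}`, a geometric series, two rational identities) — kernel-checked, no hypotheses.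

| DAG node | locator | decl | kind |
|---|---|---|---|
| `Z22:Lem15.2.pf` | [Z22 p.103, tex L5118] | `Lem152_pf` | deduction |
| `Z22:§A.u021` | [Z22 p.103, tex L5119] | `StepA_u021` (`a` PROVED: `stepA_u021a_holds`, `b`) | exact + claim |
| `Z22:(A.6)`, `Z22:(A.7)` | [Z22 pp.103–104, tex L5122, L5128] | `EqA6`, `EqA7` | claims |
| `Z22:§A.u022` … `Z22:§A.u029` | [Z22 p.104, tex L5136–L5164] | `StepA_u022` … `StepA_u029`; PROVED (Part 6): `stepA_u022_holds`, `stepA_u024a_holds`, `stepA_u024c_holds`, `stepA_u028_holds`, `stepA_u029_holds` | exact / claims |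
| `Z22:Lem15.3.pf` | [Z22 p.105, tex L5172] | `Lem153_pf` (+ `Lem153_pf_factorBound`, the in-line claim L5176) | deduction |
| `Z22:§A.u030` … `Z22:§A.u032` | [Z22 p.105, tex L5174–L5182] | `StepA_u030` … `StepA_u032` (object `frakU1Factor`) | claims |
| `Z22:Lem16.1.pf` | [Z22 p.105, tex L5194] | `Lem161_pf`; PROVED (Part 8): `lem161_pf_holds` (conclusion = sz-d57's `AppendixA.lemma161_holds`) | deduction |
| `Z22:§A.u033` … `Z22:§A.u038` | [Z22 p.105, tex L5195–L5218] | `StepA_u033` … `StepA_u038` | exact / claims |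
| `Z22:Lem16.2.pf` | [Z22 p.105, tex L5225] | `Lem162_pf` | deduction |
| `Z22:§A.u039` | [Z22 p.105, tex L5226] | `StepA_u039` | claim |
| `Z22:§A.u040` … `Z22:§A.u042` | [Z22 p.106, tex L5230–L5236] | object `Pi2` + `Pi2_of_chi_two_ne_one`, `Pi2_of_two_dvd`, `Pi2_of_coprime_two` | definition (unfolded) |

## References

* Y. Zhang, arXiv:2211.02515v1 (2022), Appendix A pp. 101–106 (tex L4963–L5236), §15 pp. 81–87
  ((15.9), (15.10), (15.13), (15.18)–(15.19), Lemmas 15.2–15.3), §16 pp. 89–94 ((16.7), (16.8),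
  (16.13), Lemmas 16.1–16.2). [cite: Zhang2022LandauSiegel, App. A; §§15–16]
-/

noncomputable section

namespace Literature.NumberTheory.LFunctions.Zhang2022.Typed.AppendixA2

open Literature.NumberTheory.LFunctions.Zhang2022.Typed.Section15A (kappa1 kappaTilde1 lam1)
open Literature.NumberTheory.LFunctions.Zhang2022.Typed.Section15B
  (xi1 lamTilde1 xi1LocalSeries calM1Factor calM1 varpi1)
open Literature.NumberTheory.LFunctions.Zhang2022.Typed.Section15C
  (eulerM1 eulerU1 calU1 IsCalU1 inputs15AB Lemma152I Lemma153I)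
open Literature.NumberTheory.LFunctions.Zhang2022.Typed.Section16A
  (kappa2 kappaTilde2 lam2 xi2 lamTilde2 xi2LocalSeries calM2Factor calM2 calM2star)
open Literature.NumberTheory.LFunctions.Zhang2022.Typed.Section16B
  (frakpFactor frakpA frakpB frakp nuConvChi varpi2 frakU2Series frakU2Main Lemma161 Lemma162)

/-! ## Part 0. The objects of this slice (the §§15–16 objects, `calU1` and `IsCalU1` are imported — module docstring) -/

section Objects

variable (c' : ℝ) {D : ℕ} (χ : DirichletCharacter ℂ D)

/-! ### Objects of Appendix A, part 2 (this slice) on the §15 side -/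

/-- The `ζ`-quotient factor at the prime `q` in (A.4) and in the first display of Lemma 15.2's proof
(p. 103, tex L5090, L5119): **`(1−q^{−s−β₁})(1−q^{−s−β₂})/((1−q^{−s})(1−χ(q)q^{−s}))`** — an
abbreviation of the printed sub-expression (the first factor of `calM1Factor`).
[cite: Zhang2022LandauSiegel, App. A (A.4) p.103] -/
def zetaFactor1 (q : ℕ) (s : ℂ) : ℂ :=
  (1 - (q : ℂ) ^ (-(s + Skeleton.beta1 c' D))) * (1 - (q : ℂ) ^ (-(s + Skeleton.beta2 c' D))) /
    ((1 - (q : ℂ) ^ (-s)) * (1 - χ (q : ZMod D) * (q : ℂ) ^ (-s)))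

/-- The `r`-sum of (A.6)/(A.7) and of the displays tex L5148, L5156 (pp. 103–104):
**`Σ_{r≥1} q^{−rs}(κ̃₁(q^r,1) − χ(q)q(q−1)⁻¹ κ₁(q^{r−1}))`** (a series in `r ≥ 1`;
`κ̃₁(q^r,1) = κ̃₁(q^r;1,1)`). An abbreviation of the printed sub-expression.
[cite: Zhang2022LandauSiegel, App. A (A.6) p.103] -/
def sumA6 (q : ℕ) (s : ℂ) : ℂ :=
  ∑' r : ℕ, if r = 0 then 0 else
    (kappaTilde1 c' χ (q ^ r) 1 1 -
        χ (q : ZMod D) * (q : ℂ) / ((q : ℂ) - 1) * kappa1 c' D (q ^ (r - 1))) /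
      (q : ℂ) ^ ((r : ℂ) * s)

/-- **`𝔲_{1j}(q,s)`**, "the factor `𝔲_{1j}(q,s)` in the Euler product representation
`𝔲_{1j}(s) = ∏_q 𝔲_{1j}(q,s)`" (App. A p. 105, tex L5174). The manuscript does not display this factor;
it is typed as the Euler factor at the prime `q` of the series defining `𝒰₁ⱼ(s)` (`calU1`) — `ϖ₁ⱼ`
being multiplicative by (15.18) and `χ(n)τ₂(n)n^{−s}` multiplicative —, i.e.
`(1−q^{−s})²(1−χ(q)q^{−s})² Σ_{r≥0} χ(q^r)τ₂(q^r)ϖ₁ⱼ(q^r)q^{−rs}`. PROVIDED by this slice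
(ASSIGNMENTS v2 row t9). [cite: Zhang2022LandauSiegel, App. A p.105] -/
def frakU1Factor (j q : ℕ) (s : ℂ) : ℂ :=
  (1 - (q : ℂ) ^ (-s)) ^ 2 * (1 - χ (q : ZMod D) * (q : ℂ) ^ (-s)) ^ 2 *
    ∑' r : ℕ, χ ((q ^ r : ℕ) : ZMod D) * (((q ^ r).divisors.card : ℕ) : ℂ) *
      varpi1 c' χ j (q ^ r) / (q : ℂ) ^ ((r : ℂ) * s)

/-! ### §16-side objects of Appendix A, part 2 (this slice) -/

/-- The `ζ`-quotient factor at the prime `q` of `𝔪₂` (§16 p. 92, tex L4570; App. A p. 105, tex L5214):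
**`(1−q^{−s−β₁})/((1−q^{−s})(1−χ(q)q^{−s}))`** — an abbreviation of the printed sub-expression (the
first factor of `calM2Factor`). [cite: Zhang2022LandauSiegel, App. A p.105] -/
def zetaFactor2 (q : ℕ) (s : ℂ) : ℂ :=
  (1 - (q : ℂ) ^ (-(s + Skeleton.beta1 c' D))) /
    ((1 - (q : ℂ) ^ (-s)) * (1 - χ (q : ZMod D) * (q : ℂ) ^ (-s)))

open scoped Classical in
/-- **`Π₂(l)`** (App. A p. 106, tex L5230–L5236, the three displays of the proof of Lemma 16.2):
`∏_{q∣l}(1 − χ(q)/(q−1))⁻¹` if `χ(2) ≠ 1`; `∏_{q∣l, q>2}(1 − χ(q)/(q−1))⁻¹` if `χ(2) = 1`, `2∣l`;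
`0` if `χ(2) = (l,2) = 1`. PROVIDED by this slice (nodes Z22:§A.u040–u042; unfolded below).
[cite: Zhang2022LandauSiegel, App. A p.106] -/
def Pi2 (l : ℕ) : ℂ :=
  if χ (2 : ZMod D) ≠ 1 then
    ∏ q ∈ l.primeFactors, (1 - χ (q : ZMod D) / ((q : ℂ) - 1))⁻¹
  else if 2 ∣ l then
    ∏ q ∈ l.primeFactors.filter (fun q => 2 < q), (1 - χ (q : ZMod D) / ((q : ℂ) - 1))⁻¹
  else 0

end Objects

/-! ## Part 1. The consumed statements (A.4), (A.5) in the readings used below (Lemmas 15.2–15.3, 16.1–16.2 are imported) -/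

section Consumed

variable (c' : ℝ)

/-- **(A.4)** (App. A p. 103, tex L5087–L5093; node Z22:(A.4) — declaration of record: L4-t8's
`Typed.AppendixA1.EqA_4`, stated for ANY analytic continuation `M` of the printed series; THIS is its
READING for `M = Section15B.calM1`, the continued Euler product the proof of Lemma 15.2 works with,
and follows from it by the proved edge `eqA4_of_eqA_4`, Part 7): "In what follows assume `dl < P₂²`,
`(dl,D) = 1` and `|s−1| < 5α`. We have
`ℳ₁(d,l;s) = ∏_{q<D} (1−q^{−s−β₁})(1−q^{−s−β₂})/((1−q^{−s})(1−χ(q)q^{−s})) (1 + λ̃₁(q,d)Σ_r ξ₁(q^r;d,l)q^{−rs})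
× (1 + O(D^{−c}))`", typed as `‖ℳ₁ − Π‖ ≤ C·D^{−c}·‖Π‖`, `Π = ∏_{q<D} calM1Factor`. CLAIM (reading).
[cite: Zhang2022LandauSiegel, App. A (A.4) p.103] -/
def EqA4 : Prop :=
  ∃ c : ℝ, 0 < c ∧ ∃ C : ℝ, Skeleton.ForAllLarge fun D _ χ => Skeleton.AssumptionA D χ →
    ∀ d l : ℕ, ∀ s : ℂ, 0 < d → 0 < l → ((d * l : ℕ) : ℝ) < Skeleton.P2 D ^ 2 →
      Nat.Coprime (d * l) D → ‖s - 1‖ < 5 * Skeleton.alpha D →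
        ‖calM1 c' χ d l s - ∏ q ∈ (Finset.range D).filter Nat.Prime, calM1Factor c' χ q d l s‖ ≤
          C * (D : ℝ) ^ (-c) * ‖∏ q ∈ (Finset.range D).filter Nat.Prime, calM1Factor c' χ q d l s‖

/-- **(A.5)** (App. A p. 103, tex L5095–L5104; node Z22:(A.5) — declaration of record: L4-t8's
`Typed.AppendixA1.EqA_5` (the two cases as two implications); THIS is the same identity as ONE
`if … then … else` equation, and follows from it by the proved edge `eqA5_of_eqA_5`, Part 7): "Note
that `κ̃₁(q^{r−1},dq) = κ₁(q^{r−1})`, so that `ξ₁(q^r;d,l) = κ̃₁(q^r,d) − χ(q)q(q−1)⁻¹κ₁(q^{r−1})` if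
`(q,l) = 1`, `= κ̃₁(q^r,d)` if `q∣l`, for any `q`, `d`, `l` and `r`" (`q` prime, `r ≥ 1`;
`κ̃₁(q^r,d) = κ̃₁(q^r;d,1)`). EXACT identity, typed unconditionally (moduli `D ≥ 1`, as in `EqA_5`).
[cite: Zhang2022LandauSiegel, App. A (A.5) p.103] -/
def EqA5 : Prop :=
  ∀ (D : ℕ) [NeZero D] (χ : DirichletCharacter ℂ D) (q d l r : ℕ),
    q.Prime → 0 < d → 0 < l → 1 ≤ r →
      xi1 c' χ (q ^ r) d l =
        if Nat.Coprime q l then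
          kappaTilde1 c' χ (q ^ r) d 1 -
            χ (q : ZMod D) * (q : ℂ) / ((q : ℂ) - 1) * kappa1 c' D (q ^ (r - 1))
        else kappaTilde1 c' χ (q ^ r) d 1

end Consumed

/-! ## Part 2. Proof of Lemma 15.2 (pp. 103–104, tex L5118–L5168) -/

section ProofOfLemma152

variable (c' : ℝ)

/-- **Z22:§A.u021, first relation** [Z22 p.103, tex L5119]: "`λ̃₁(q^r,1) = λ₁(q)`" (`q` prime,
`r ≥ 1`; `λ₁(q) = λ₁(q,1)`). EXACT identity, typed unconditionally.
[cite: Zhang2022LandauSiegel, App. A p.103] -/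
def StepA_u021a : Prop :=
  ∀ (D : ℕ) (χ : DirichletCharacter ℂ D) (q r : ℕ), q.Prime → 1 ≤ r →
    lamTilde1 c' χ (q ^ r) 1 = lam1 c' χ q 1

/-- **Z22:§A.u021, second relation** [Z22 p.103, tex L5119]:
"`(1−q^{−s−β₁})(1−q^{−s−β₂})/((1−q^{−s})(1−χ(q)q^{−s})) = (1−q⁻¹)/(1−χ(q)q⁻¹) + O(α log q/q)`"
(context: `|s − 1| < 5α`, primes `q < D` as in (A.4)). CLAIM.
[cite: Zhang2022LandauSiegel, App. A p.103] -/
def StepA_u021b : Prop :=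
  ∃ C : ℝ, Skeleton.ForAllLarge fun D _ χ => Skeleton.AssumptionA D χ →
    ∀ q : ℕ, ∀ s : ℂ, q.Prime → q < D → ‖s - 1‖ < 5 * Skeleton.alpha D →
      ‖zetaFactor1 c' χ q s - (1 - (q : ℂ)⁻¹) / (1 - χ (q : ZMod D) * (q : ℂ)⁻¹)‖ ≤
        C * (Skeleton.alpha D * Real.log q / q)

/-- **Z22:§A.u021** [Z22 p.103, tex L5119]: "By (A.4), (A.5) and the relations `λ̃₁(q^r,1) = λ₁(q)`,
`(1−q^{−s−β₁})(1−q^{−s−β₂})/((1−q^{−s})(1−χ(q)q^{−s})) = (1−q⁻¹)/(1−χ(q)q⁻¹) + O(α log q/q)`" — the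
display's two relations (`StepA_u021a ∧ StepA_u021b`). [cite: Zhang2022LandauSiegel, App. A p.103] -/
def StepA_u021 : Prop := StepA_u021a c' ∧ StepA_u021b c'

/-- **(A.6)** [Z22 p.103, (A.6), tex L5122]: "it suffices to show that
`1 + λ₁(q)Σ_r q^{−rs}(κ̃₁(q^r,1) − χ(q)q(q−1)⁻¹κ₁(q^{r−1})) = (1−χ(q)q⁻¹)/(1−q⁻¹) · (1−χ(q)q⁻²)/(1−q⁻²)
+ O(α log q/q)` if `q < D`, `(q,D) = 1`" (context `|s−1| < 5α`; node Z22:(A.6)). CLAIM; refines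
`Skeleton.Ded1524`. [cite: Zhang2022LandauSiegel, App. A (A.6) p.103] -/
def EqA6 : Prop :=
  ∃ C : ℝ, Skeleton.ForAllLarge fun D _ χ => Skeleton.AssumptionA D χ →
    ∀ q : ℕ, ∀ s : ℂ, q.Prime → q < D → Nat.Coprime q D → ‖s - 1‖ < 5 * Skeleton.alpha D →
      ‖1 + lam1 c' χ q 1 * sumA6 c' χ q s -
          (1 - χ (q : ZMod D) * (q : ℂ)⁻¹) / (1 - (q : ℂ)⁻¹) *
            ((1 - χ (q : ZMod D) * (q : ℂ)⁻¹ ^ 2) / (1 - (q : ℂ)⁻¹ ^ 2))‖ ≤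
        C * (Skeleton.alpha D * Real.log q / q)

/-- **(A.7)** [Z22 p.104, (A.7), tex L5128]: "and
`1 + λ₁(q)Σ_r q^{−rs}(κ̃₁(q^r,1) − χ(q)q(q−1)⁻¹κ₁(q^{r−1})) = 1/(1−q⁻¹) + O(α log q/q)` if `q∣D`"
(context `|s−1| < 5α`, `q < D`; node Z22:(A.7)). CLAIM; refines `Skeleton.Ded1524`.
[cite: Zhang2022LandauSiegel, App. A (A.7) p.104] -/
def EqA7 : Prop :=
  ∃ C : ℝ, Skeleton.ForAllLarge fun D _ χ => Skeleton.AssumptionA D χ →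
    ∀ q : ℕ, ∀ s : ℂ, q.Prime → q < D → q ∣ D → ‖s - 1‖ < 5 * Skeleton.alpha D →
      ‖1 + lam1 c' χ q 1 * sumA6 c' χ q s - 1 / (1 - (q : ℂ)⁻¹)‖ ≤
        C * (Skeleton.alpha D * Real.log q / q)

/-- **Z22:§A.u022** [Z22 p.104, tex L5136]: "Assume `q < D`. Since
`κ₁(q^r) = Σ_{μ₁+μ₂=r} q^{−μ₁β₁−μ₂β₂} − Σ_{μ₁+μ₂=r−1} q^{−μ₁β₁−μ₂β₂}`, where `μ₁` and `μ₂` run through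
non-negative integers" (`q` prime, `r ≥ 1`). EXACT identity, typed unconditionally (it does not use
`q < D`). [cite: Zhang2022LandauSiegel, App. A p.104] -/
def StepA_u022 : Prop :=
  ∀ (D q r : ℕ), q.Prime → 1 ≤ r →
    kappa1 c' D (q ^ r) =
      (∑ μ ∈ Finset.HasAntidiagonal.antidiagonal r,
          (q : ℂ) ^ (-((μ.1 : ℂ) * Skeleton.beta1 c' D + (μ.2 : ℂ) * Skeleton.beta2 c' D))) -
        ∑ μ ∈ Finset.HasAntidiagonal.antidiagonal (r - 1),
          (q : ℂ) ^ (-((μ.1 : ℂ) * Skeleton.beta1 c' D + (μ.2 : ℂ) * Skeleton.beta2 c' D))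

/-- **Z22:§A.u023** [Z22 p.104, tex L5140]: "it follows that `κ₁(q^r) = 1 + O(αr log q)` if `q^r < P`"
(context: "Assume `q < D`"; `r ≥ 1`). CLAIM. [cite: Zhang2022LandauSiegel, App. A p.104] -/
def StepA_u023 : Prop :=
  ∃ C : ℝ, Skeleton.ForAllLarge fun D _ χ => Skeleton.AssumptionA D χ →
    ∀ q r : ℕ, q.Prime → q < D → 1 ≤ r → ((q ^ r : ℕ) : ℝ) < Skeleton.bigP D →
      ‖kappa1 c' D (q ^ r) - 1‖ ≤ C * (Skeleton.alpha D * r * Real.log q)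

open scoped Classical in
/-- **Z22:§A.u024, first equality** [Z22 p.104, tex L5144]: "`κ̃₁(q^r,1) = Σ_{h∈𝔫(q)} κ₁(q^rh)χ(h)/h`"
(`κ̃₁(q^r,1) = κ̃₁(q^r;1,1)`; `𝔫(q^r) = 𝔫(q)`; `q` prime, `r ≥ 1`). EXACT identity, typed unconditionally.
[cite: Zhang2022LandauSiegel, App. A p.104] -/
def StepA_u024a : Prop :=
  ∀ (D : ℕ) (χ : DirichletCharacter ℂ D) (q r : ℕ), q.Prime → 1 ≤ r →
    kappaTilde1 c' χ (q ^ r) 1 1 =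
      ∑' h : ℕ, if h ∈ Skeleton.nset q then kappa1 c' D (q ^ r * h) * χ (h : ZMod D) / (h : ℂ) else 0

open scoped Classical in
/-- **Z22:§A.u024, middle estimate** [Z22 p.104, tex L5144]:
"`Σ_{h∈𝔫(q)} κ₁(q^rh)χ(h)/h = Σ_{h∈𝔫(q)} χ(h)/h + O(αr log q)`" (context: `q < D`, and "if `q^r < P`.
Hence" — the range of `r` is inherited from `StepA_u023`). CLAIM. [cite: Zhang2022LandauSiegel, App. A p.104] -/
def StepA_u024b : Prop :=
  ∃ C : ℝ, Skeleton.ForAllLarge fun D _ χ => Skeleton.AssumptionA D χ →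
    ∀ q r : ℕ, q.Prime → q < D → 1 ≤ r → ((q ^ r : ℕ) : ℝ) < Skeleton.bigP D →
      ‖(∑' h : ℕ, if h ∈ Skeleton.nset q then
            kappa1 c' D (q ^ r * h) * χ (h : ZMod D) / (h : ℂ) else 0) -
          ∑' h : ℕ, (if h ∈ Skeleton.nset q then χ (h : ZMod D) / (h : ℂ) else 0)‖ ≤
        C * (Skeleton.alpha D * r * Real.log q)

open scoped Classical in
/-- **Z22:§A.u024, last equality** [Z22 p.104, tex L5144]: "`Σ_{h∈𝔫(q)} χ(h)/h = 1/(1 − vu)`"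
(`u = q⁻¹`, `v = χ(q)`; a geometric series; `q` prime). EXACT identity, typed unconditionally.
[cite: Zhang2022LandauSiegel, App. A p.104] -/
def StepA_u024c : Prop :=
  ∀ (D : ℕ) (χ : DirichletCharacter ℂ D) (q : ℕ), q.Prime →
    (∑' h : ℕ, (if h ∈ Skeleton.nset q then χ (h : ZMod D) / (h : ℂ) else 0)) =
      1 / (1 - χ (q : ZMod D) * (q : ℂ)⁻¹)

/-- **Z22:§A.u024** [Z22 p.104, tex L5144]: "Hence
`κ̃₁(q^r,1) = Σ_{h∈𝔫(q)} κ₁(q^rh)χ(h)/h = Σ_{h∈𝔫(q)} χ(h)/h + O(αr log q) = 1/(1−vu) + O(αr log q)`" —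
the display's three relations (`StepA_u024a ∧ StepA_u024b ∧ StepA_u024c`).
[cite: Zhang2022LandauSiegel, App. A p.104] -/
def StepA_u024 : Prop := StepA_u024a c' ∧ StepA_u024b c' ∧ StepA_u024c

/-- **Z22:§A.u025** [Z22 p.104, tex L5148]: "It follows that
`Σ_r q^{−rs}(κ̃₁(q^r,1) − χ(q)q(q−1)⁻¹κ₁(q^{r−1})) = u(1−u)⁻¹ (1/(1−vu) − v/(1−u)) + O(α log q/q)`"
(`u = q⁻¹`, `v = χ(q)`; context `q < D`, `|s−1| < 5α`). PRINT DEFECT: the display has a doubled minus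
sign "`κ̃₁(q^r,1)−−χ(q)q/(q−1)…`"; read as the single `−` of (A.6) and flagged here. CLAIM.
[cite: Zhang2022LandauSiegel, App. A p.104] -/
def StepA_u025 : Prop :=
  ∃ C : ℝ, Skeleton.ForAllLarge fun D _ χ => Skeleton.AssumptionA D χ →
    ∀ q : ℕ, ∀ s : ℂ, q.Prime → q < D → ‖s - 1‖ < 5 * Skeleton.alpha D →
      ‖sumA6 c' χ q s -
          (q : ℂ)⁻¹ / (1 - (q : ℂ)⁻¹) *
            (1 / (1 - χ (q : ZMod D) * (q : ℂ)⁻¹) - χ (q : ZMod D) / (1 - (q : ℂ)⁻¹))‖ ≤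
        C * (Skeleton.alpha D * Real.log q / q)

/-- **Z22:§A.u026** [Z22 p.104, tex L5152]: "the relation `λ₁(q) = 1 − vu + O(α log q/q)`"
(`λ₁(q) = λ₁(q,1)`, `u = q⁻¹`, `v = χ(q)`; context `q < D`). CLAIM.
[cite: Zhang2022LandauSiegel, App. A p.104] -/
def StepA_u026 : Prop :=
  ∃ C : ℝ, Skeleton.ForAllLarge fun D _ χ => Skeleton.AssumptionA D χ →
    ∀ q : ℕ, q.Prime → q < D →
      ‖lam1 c' χ q 1 - (1 - χ (q : ZMod D) * (q : ℂ)⁻¹)‖ ≤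
        C * (Skeleton.alpha D * Real.log q / q)

/-- **Z22:§A.u027** [Z22 p.104, tex L5156]: "yields
`1 + λ₁(q)Σ_r q^{−rs}(κ̃₁(q^r,1) − χ(q)q(q−1)⁻¹κ₁(q^{r−1})) = 1/(1−u) − uv(1−vu)/(1−u)² + O(α log q/q)`"
(`u = q⁻¹`, `v = χ(q)`; context `q < D`, `|s−1| < 5α`). CLAIM. [cite: Zhang2022LandauSiegel, App. A p.104] -/
def StepA_u027 : Prop :=
  ∃ C : ℝ, Skeleton.ForAllLarge fun D _ χ => Skeleton.AssumptionA D χ →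
    ∀ q : ℕ, ∀ s : ℂ, q.Prime → q < D → ‖s - 1‖ < 5 * Skeleton.alpha D →
      ‖1 + lam1 c' χ q 1 * sumA6 c' χ q s -
          (1 / (1 - (q : ℂ)⁻¹) -
            (q : ℂ)⁻¹ * χ (q : ZMod D) * (1 - χ (q : ZMod D) * (q : ℂ)⁻¹) / (1 - (q : ℂ)⁻¹) ^ 2)‖ ≤
        C * (Skeleton.alpha D * Real.log q / q)

/-- **Z22:§A.u028** [Z22 p.104, tex L5160]: "It is direct to verify that
`1/(1−u) − uv(1−vu)/(1−u)² = (1−χ(q)q⁻¹)/(1−q⁻¹) · (1−χ(q)q⁻²)/(1−q⁻²)` if `χ(q) = ±1`" (`u = q⁻¹`,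
`v = χ(q)`, `q` prime). EXACT identity, typed unconditionally. [cite: Zhang2022LandauSiegel, App. A p.104] -/
def StepA_u028 : Prop :=
  ∀ (D : ℕ) (χ : DirichletCharacter ℂ D) (q : ℕ), q.Prime →
    (χ (q : ZMod D) = 1 ∨ χ (q : ZMod D) = -1) →
      1 / (1 - (q : ℂ)⁻¹) -
          (q : ℂ)⁻¹ * χ (q : ZMod D) * (1 - χ (q : ZMod D) * (q : ℂ)⁻¹) / (1 - (q : ℂ)⁻¹) ^ 2 =
        (1 - χ (q : ZMod D) * (q : ℂ)⁻¹) / (1 - (q : ℂ)⁻¹) *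
          ((1 - χ (q : ZMod D) * (q : ℂ)⁻¹ ^ 2) / (1 - (q : ℂ)⁻¹ ^ 2))

/-- **Z22:§A.u029** [Z22 p.104, tex L5164]: "and `1/(1−u) − uv(1−vu)/(1−u)² = 1/(1−q⁻¹)` if `χ(q) = 0`,
whence (A.6) and (A.7) follow." EXACT identity, typed unconditionally. [cite: Zhang2022LandauSiegel, App. A p.104] -/
def StepA_u029 : Prop :=
  ∀ (D : ℕ) (χ : DirichletCharacter ℂ D) (q : ℕ), q.Prime → χ (q : ZMod D) = 0 →
    1 / (1 - (q : ℂ)⁻¹) -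
        (q : ℂ)⁻¹ * χ (q : ZMod D) * (1 - χ (q : ZMod D) * (q : ℂ)⁻¹) / (1 - (q : ℂ)⁻¹) ^ 2 =
      1 / (1 - (q : ℂ)⁻¹)

/-- **Z22:Lem15.2.pf** [Z22 pp.103–104, tex L5118–L5168] — the manuscript's DEDUCTION of Lemma 15.2:
"By (A.4), (A.5) and the relations [u021] it suffices to show (A.6) if `q < D`, `(q,D) = 1`, and (A.7)
if `q∣D`." Typed as the implication (A.4) → (A.5) → u021 → (A.6) → (A.7) → Lemma 15.2, the target
being L4-t3's statement of record `Section15C.Lemma152I c'` (= `Lemma152 c' inputs15AB`; unfolded in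
`lemma152I_iff`). DAG cites: (A.4), (A.5), (A.6), (A.7), Lem15.2. Refines `Skeleton.Ded1524`.
[cite: Zhang2022LandauSiegel, App. A pp.103–104] -/
def Lem152_pf : Prop :=
  EqA4 c' → EqA5 c' → StepA_u021 c' → EqA6 c' → EqA7 c' → Lemma152I c'

end ProofOfLemma152

/-! ## Part 3. Proof of Lemma 15.3 (p. 105, tex L5172–L5185; "a sketch only") -/

section ProofOfLemma153

variable (c' : ℝ)

/-- **Z22:§A.u030** [Z22 p.105, tex L5174]: "the Euler product representation
`𝔲_{1j}(s) = ∏_q 𝔲_{1j}(q,s)`" — typed on `σ > 1`, where the printed definition of `𝒰₁ⱼ`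
(`Section15C.calU1` at t3's instance `inputs15AB`, i.e. with `ϖ₁ⱼ = Section15B.varpi1`) is literal,
with the factor `frakU1Factor` and a `tprod` over `Nat.Primes`; `1 ≤ j ≤ 3`. CLAIM.
[cite: Zhang2022LandauSiegel, App. A p.105] -/
def StepA_u030 : Prop :=
  Skeleton.ForAllLarge fun D _ χ => Skeleton.AssumptionA D χ →
    ∀ j ∈ ({1, 2, 3} : Finset ℕ), ∀ s : ℂ, 1 < s.re →
      calU1 c' inputs15AB χ j s = ∏' q : Nat.Primes, frakU1Factor c' χ j (q : ℕ) s

/-- **In-line claim of Z22:Lem15.3.pf** [Z22 p.105, tex L5176, not displayed]: "it can be verified that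
the factor `𝔲_{1j}(q,s)` … satisfies `𝔲_{1j}(q,s) = 1 + O(q^{−2σ})` if `(q,D) = 1`" (range of `σ`: the
lemma's `σ ≥ 9/10`). CLAIM (no DAG id of its own; reported with `Z22:Lem15.3.pf`), typed AS PRINTED.
FLAG — inherits GAP row G-L4t3-1 (the PRINTED normaliser `(ζ(s)²L(s,χ)²)⁻¹`, local factor
`(1−q^{−s})²(1−χ(q)q^{−s})²` in `frakU1Factor`): with `ϖ₁ⱼ(q) = χ(q) + q^{βⱼ} + O(q^{−9/10})` at the
primes ((15.18)–(15.21)) the `q^{−s}`-coefficient of `frakU1Factor − 1` is `2χ(q)(q^{βⱼ} − 1) ≠ 0`, so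
this pointwise `∀ q` bound is a printed-false candidate (cross-reads L4-t9 23:49Z, L4-t8 01:08Z); the
cell's repair replaces the local normaliser by `(1−q^{−s})²(1−χ(q)q^{βⱼ−s})²` (L4-t3's
`Section15C.calU1R`), for which "`1 + O(q^{−2σ})`" is the right claim. Stated, not asserted; a
vacuous discharge of `Lem153_pf` through a refuted antecedent is not a discharge of Lemma 15.3.
[cite: Zhang2022LandauSiegel, App. A p.105] -/
def Lem153_pf_factorBound : Prop :=
  ∃ C : ℝ, Skeleton.ForAllLarge fun D _ χ => Skeleton.AssumptionA D χ →
    ∀ j ∈ ({1, 2, 3} : Finset ℕ), ∀ q : ℕ, ∀ s : ℂ, q.Prime → Nat.Coprime q D → 9 / 10 ≤ s.re →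
      ‖frakU1Factor c' χ j q s - 1‖ ≤ C * (q : ℝ) ^ (-(2 * s.re))

/-- **Z22:§A.u031** [Z22 p.105, tex L5178]: "Further, in the case `q ≤ D` we have
`𝔲_{1j}(q,1) = (1−q⁻¹)² + O(α₁/q)` if `q∣D`" (`α₁` read as `α𝓛`). CLAIM.
[cite: Zhang2022LandauSiegel, App. A p.105] -/
def StepA_u031 : Prop :=
  ∃ C : ℝ, Skeleton.ForAllLarge fun D _ χ => Skeleton.AssumptionA D χ →
    ∀ j ∈ ({1, 2, 3} : Finset ℕ), ∀ q : ℕ, q.Prime → q ≤ D → q ∣ D →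
      ‖frakU1Factor c' χ j q 1 - (1 - (q : ℂ)⁻¹) ^ 2‖ ≤
        C * (Skeleton.alpha D * Skeleton.ell D / q)

/-- **Z22:§A.u032** [Z22 p.105, tex L5182]: "and `𝔲_{1j}(q,1) = (1−q⁻²)²/(1−χ(q)q⁻²) + O(α₁/q)` if
`(q,D) = 1`" (case `q ≤ D`). CLAIM. [cite: Zhang2022LandauSiegel, App. A p.105] -/
def StepA_u032 : Prop :=
  ∃ C : ℝ, Skeleton.ForAllLarge fun D _ χ => Skeleton.AssumptionA D χ →
    ∀ j ∈ ({1, 2, 3} : Finset ℕ), ∀ q : ℕ, q.Prime → q ≤ D → Nat.Coprime q D →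
      ‖frakU1Factor c' χ j q 1 - (1 - (q : ℂ)⁻¹ ^ 2) ^ 2 / (1 - χ (q : ZMod D) * (q : ℂ)⁻¹ ^ 2)‖ ≤
        C * (Skeleton.alpha D * Skeleton.ell D / q)

/-- **Z22:Lem15.3.pf** [Z22 p.105, tex L5172–L5185] — the manuscript's DEDUCTION of Lemma 15.3 ("We
give a sketch only, as the situation is similar to Lemma 15.2"): the Euler product u030, the factor
bound `1 + O(q^{−2σ})` for `(q,D) = 1`, and the values u031/u032 at `s = 1` for `q ≤ D`; "This completes
the proof." Typed as the implication, the target being L4-t3's statement of record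
`Section15C.Lemma153I c'` (= `Lemma153 c' inputs15AB`, AS PRINTED; unfolded in `lemma153I_iff`).
DAG cites: Lem15.3, Lem15.2. Refines `Skeleton.Ded1524`. [cite: Zhang2022LandauSiegel, App. A p.105] -/
def Lem153_pf : Prop :=
  StepA_u030 c' → Lem153_pf_factorBound c' → StepA_u031 c' → StepA_u032 c' → Lemma153I c'

end ProofOfLemma153

/-! ## Part 4. Proof of Lemma 16.1 (p. 105, tex L5194–L5222) -/

section ProofOfLemma161

variable (c' : ℝ)

/-- **Z22:§A.u033** [Z22 p.105, tex L5195]: "For any `q`, `r`, `d` and `l` we have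
`ξ₂(q^r;d,l) = κ̃₂(q^r;d) − χ(q)q(q−1)⁻¹κ₂(q^{r−1})` if `(q,l) = 1`, `= κ̃₂(q^r;d)` if `q∣l`"
(`κ̃₂(q^r;d) = κ̃₂(q^r;d,1)`; `q` prime, `r ≥ 1`). EXACT identity, typed unconditionally.
[cite: Zhang2022LandauSiegel, App. A p.105] -/
def StepA_u033 : Prop :=
  ∀ (D : ℕ) [NeZero D] (χ : DirichletCharacter ℂ D) (q r d l : ℕ),
    q.Prime → 1 ≤ r → 0 < d → 0 < l →
      xi2 c' χ (q ^ r) d l =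
        if Nat.Coprime q l then
          kappaTilde2 c' χ (q ^ r) d 1 -
            χ (q : ZMod D) * (q : ℂ) / ((q : ℂ) - 1) * kappa2 c' D (q ^ (r - 1))
        else kappaTilde2 c' χ (q ^ r) d 1

/-- **Z22:§A.u034, the identity for `κ₂`** [Z22 p.105, tex L5202]: "`|κ₂(q^r)| = |q^{−β₁} − 1|`" (`q`
prime, `r ≥ 1`). EXACT identity, typed unconditionally. [cite: Zhang2022LandauSiegel, App. A p.105] -/
def StepA_u034a : Prop :=
  ∀ (D q r : ℕ), q.Prime → 1 ≤ r →
    ‖kappa2 c' D (q ^ r)‖ = ‖(q : ℂ) ^ (-Skeleton.beta1 c' D) - 1‖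

/-- **Z22:§A.u034, the bound** [Z22 p.105, tex L5202]: "`|q^{−β₁} − 1| ≪ α log q`" (every prime `q`).
CLAIM. [cite: Zhang2022LandauSiegel, App. A p.105] -/
def StepA_u034b : Prop :=
  ∃ C : ℝ, Skeleton.ForAllLarge fun D _ χ => Skeleton.AssumptionA D χ →
    ∀ q : ℕ, q.Prime → ‖(q : ℂ) ^ (-Skeleton.beta1 c' D) - 1‖ ≤ C * (Skeleton.alpha D * Real.log q)

/-- **Z22:§A.u034, the relation for `λ̃₂`** [Z22 p.105, tex L5202]: "`λ̃₂(q,d) = 1 + O(α log q/q)`"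
("for any `q` … `d`"; `q` prime). CLAIM. [cite: Zhang2022LandauSiegel, App. A p.105] -/
def StepA_u034c : Prop :=
  ∃ C : ℝ, Skeleton.ForAllLarge fun D _ χ => Skeleton.AssumptionA D χ →
    ∀ q d : ℕ, q.Prime → 0 < d →
      ‖lamTilde2 c' χ q d - 1‖ ≤ C * (Skeleton.alpha D * Real.log q / q)

/-- **Z22:§A.u034** [Z22 p.105, tex L5202]: "`|κ₂(q^r)| = |q^{−β₁} − 1| ≪ α log q`,
`λ̃₂(q,d) = 1 + O(α log q/q)`" — the display's three claims (`StepA_u034a ∧ StepA_u034b ∧ StepA_u034c`).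
[cite: Zhang2022LandauSiegel, App. A p.105] -/
def StepA_u034 : Prop := StepA_u034a c' ∧ StepA_u034b c' ∧ StepA_u034c c'

/-- **Z22:§A.u035** [Z22 p.105, tex L5206]: "Hence
`1 + λ̃₂(q,d)Σ_r ξ₂(q^r;d,l)q^{−rs} = 1 − χ(q)/(q−1) + O(α log q/q)` if `(q,l) = 1`" (context: Lemma
16.1's `|s − 1| < 5α`; RANGE OF `q` NOT PRINTED — typed for the primes `q < D` over which the ensuing
display u038 takes its products; flagged, not silently added). CLAIM; refines `Skeleton.Ded1617`.
[cite: Zhang2022LandauSiegel, App. A p.105] -/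
def StepA_u035 : Prop :=
  ∃ C : ℝ, Skeleton.ForAllLarge fun D _ χ => Skeleton.AssumptionA D χ →
    ∀ q d l : ℕ, ∀ s : ℂ, q.Prime → q < D → 0 < d → 0 < l → Nat.Coprime q l →
      ‖s - 1‖ < 5 * Skeleton.alpha D →
        ‖1 + lamTilde2 c' χ q d * xi2LocalSeries c' χ q d l s -
            (1 - χ (q : ZMod D) / ((q : ℂ) - 1))‖ ≤
          C * (Skeleton.alpha D * Real.log q / q)

/-- **Z22:§A.u036** [Z22 p.105, tex L5210]: "and `1 + λ̃₂(q,d)Σ_r ξ₂(q^r;d,l)q^{−rs} = 1 + O(α log q/q)`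
if `q∣l`" (context `|s−1| < 5α`; range `q < D` as for u035, flagged). CLAIM.
[cite: Zhang2022LandauSiegel, App. A p.105] -/
def StepA_u036 : Prop :=
  ∃ C : ℝ, Skeleton.ForAllLarge fun D _ χ => Skeleton.AssumptionA D χ →
    ∀ q d l : ℕ, ∀ s : ℂ, q.Prime → q < D → 0 < d → 0 < l → q ∣ l →
      ‖s - 1‖ < 5 * Skeleton.alpha D →
        ‖1 + lamTilde2 c' χ q d * xi2LocalSeries c' χ q d l s - 1‖ ≤
          C * (Skeleton.alpha D * Real.log q / q)

/-- **Z22:§A.u037** [Z22 p.105, tex L5214]: "On the other hand we have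
`(1−q^{−s−β₁})/((1−q^{−s})(1−χ(q)q^{−s})) = 1/(1−χ(q)q⁻¹) + O(α log q/q)`" (context `|s−1| < 5α`;
range `q < D` as for u035, flagged). CLAIM. [cite: Zhang2022LandauSiegel, App. A p.105] -/
def StepA_u037 : Prop :=
  ∃ C : ℝ, Skeleton.ForAllLarge fun D _ χ => Skeleton.AssumptionA D χ →
    ∀ q : ℕ, ∀ s : ℂ, q.Prime → q < D → ‖s - 1‖ < 5 * Skeleton.alpha D →
      ‖zetaFactor2 c' χ q s - 1 / (1 - χ (q : ZMod D) * (q : ℂ)⁻¹)‖ ≤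
        C * (Skeleton.alpha D * Real.log q / q)

/-- **Z22:§A.u038** [Z22 p.105, tex L5218]: "It follows that
`𝔪₂(d,l;s) = ∏_{q<D,(q,l)=1} (1−χ(q)q⁻¹)⁻¹(1 − χ(q)/(q−1)) ∏_{q<D,q∣l} (1−χ(q)q⁻¹)⁻¹ + O(α₁)`"
(hypotheses of Lemma 16.1: `dl < PT⁻²`, `|s−1| < 5α`; `α₁` read as `α𝓛`). CLAIM; refines
`Skeleton.Ded1617`. [cite: Zhang2022LandauSiegel, App. A p.105] -/
def StepA_u038 : Prop :=
  ∃ C : ℝ, Skeleton.ForAllLarge fun D _ χ => Skeleton.AssumptionA D χ →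
    ∀ d l : ℕ, ∀ s : ℂ, 0 < d → 0 < l →
      ((d * l : ℕ) : ℝ) < Skeleton.bigP D / Skeleton.bigT D ^ 2 → ‖s - 1‖ < 5 * Skeleton.alpha D →
        ‖calM2 c' χ d l s -
            (∏ q ∈ (Finset.range D).filter (fun q => q.Prime ∧ Nat.Coprime q l),
                (1 - χ (q : ZMod D) * (q : ℂ)⁻¹)⁻¹ * (1 - χ (q : ZMod D) / ((q : ℂ) - 1))) *
              ∏ q ∈ (Finset.range D).filter (fun q => q.Prime ∧ q ∣ l),
                (1 - χ (q : ZMod D) * (q : ℂ)⁻¹)⁻¹‖ ≤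
          C * (Skeleton.alpha D * Skeleton.ell D)

/-- **Z22:Lem16.1.pf** [Z22 p.105, tex L5194–L5222] — the manuscript's DEDUCTION of Lemma 16.1 from the
displays u033–u038: "It is direct to verify that in either case [`χ(2) ≠ 1`, `χ(2) = 1`] the assertion
holds." Typed as the implication. DAG cites: Lem16.1. Refines `Skeleton.Ded1617`.
[cite: Zhang2022LandauSiegel, App. A p.105] -/
def Lem161_pf : Prop :=
  StepA_u033 c' → StepA_u034 c' → StepA_u035 c' → StepA_u036 c' → StepA_u037 c' →
    StepA_u038 c' → Lemma161 c'

end ProofOfLemma161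

/-! ## Part 5. Proof of Lemma 16.2 (pp. 105–106, tex L5225–L5237; "a sketch only") -/

section ProofOfLemma162

variable (c' : ℝ) {D : ℕ} (χ : DirichletCharacter ℂ D)

/-- **Z22:§A.u039** [Z22 p.105, tex L5226]: "If `dl < D`, `(dl,D) = 1` and `|s − 1| ≤ 5α`, then
`𝔪₂(d,l;s)/𝔪₂*(s) = Π₂(l) + O(α₁τ₂(dl))`" (`≤` as printed here; `α₁` read as `α𝓛`; `τ₂` = the number of
divisors). CLAIM; refines `Skeleton.Ded1617`. [cite: Zhang2022LandauSiegel, App. A p.105] -/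
def StepA_u039 : Prop :=
  ∃ C : ℝ, Skeleton.ForAllLarge fun D _ χ => Skeleton.AssumptionA D χ →
    ∀ d l : ℕ, ∀ s : ℂ, 0 < d → 0 < l → d * l < D → Nat.Coprime (d * l) D →
      ‖s - 1‖ ≤ 5 * Skeleton.alpha D →
        ‖calM2 c' χ d l s / calM2star c' χ s - Pi2 χ l‖ ≤
          C * (Skeleton.alpha D * Skeleton.ell D * ((d * l).divisors.card : ℝ))

/-- **Z22:§A.u040** [Z22 p.106, tex L5230]: "`Π₂(l) = ∏_{q∣l} (1 − χ(q)/(q−1))⁻¹` if `χ(2) ≠ 1`" —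
the first defining clause of `Pi2`, unfolded. [cite: Zhang2022LandauSiegel, App. A p.106] -/
theorem Pi2_of_chi_two_ne_one (l : ℕ) (h : χ (2 : ZMod D) ≠ 1) :
    Pi2 χ l = ∏ q ∈ l.primeFactors, (1 - χ (q : ZMod D) / ((q : ℂ) - 1))⁻¹ := by
  simp [Pi2, h]

/-- **Z22:§A.u041** [Z22 p.106, tex L5233]: "`Π₂(l) = ∏_{q∣l, q>2} (1 − χ(q)/(q−1))⁻¹` if `χ(2) = 1`,
`2∣l`" — the second defining clause of `Pi2`, unfolded. [cite: Zhang2022LandauSiegel, App. A p.106] -/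
theorem Pi2_of_two_dvd (l : ℕ) (h : χ (2 : ZMod D) = 1) (hl : 2 ∣ l) :
    Pi2 χ l = ∏ q ∈ l.primeFactors.filter (fun q => 2 < q), (1 - χ (q : ZMod D) / ((q : ℂ) - 1))⁻¹ := by
  simp [Pi2, h, hl]

/-- **Z22:§A.u042** [Z22 p.106, tex L5236]: "`Π₂(l) = 0` if `χ(2) = (l,2) = 1`" — the third defining
clause of `Pi2`, unfolded. [cite: Zhang2022LandauSiegel, App. A p.106] -/
theorem Pi2_of_coprime_two (l : ℕ) (h : χ (2 : ZMod D) = 1) (hl : Nat.Coprime l 2) :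
    Pi2 χ l = 0 := by
  have h2 : ¬ 2 ∣ l := fun h2 => absurd ((Nat.Coprime.symm hl).eq_one_of_dvd h2) (by decide)
  simp [Pi2, h, h2]

/-- **Z22:Lem16.2.pf** [Z22 pp.105–106, tex L5225–L5237] — the manuscript's DEDUCTION of Lemma 16.2 ("We
give a sketch only"): from u039 (with `Π₂` as defined by u040–u042), "The assertion follows by
discussing the cases `χ(2) ≠ 1` and `χ(2) = 1` respectively." Typed as the implication. DAG cites:
Lem16.2. Refines `Skeleton.Ded1617`. [cite: Zhang2022LandauSiegel, App. A pp.105–106] -/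
def Lem162_pf : Prop := StepA_u039 c' → Lemma162 c'

end ProofOfLemma162


/-! ## Part 6. Discharges of identity leaves of the proof of Lemma 15.2 (kernel-checked) -/

section Discharges

variable (c' : ℝ)

/-- `β₁ = i b₁` (the skeleton's `beta1` versus `b1`). [cite: Zhang2022LandauSiegel, §2 (2.13)] -/
private theorem beta1_eq_b1_mul_I (D : ℕ) :
    Skeleton.beta1 c' D = (Skeleton.b1 c' D : ℂ) * Complex.I := by
  simp only [Skeleton.beta1, Skeleton.b1]; push_cast; ring

/-- `β₂ = i b₂`. [cite: Zhang2022LandauSiegel, §2 (2.13)] -/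
private theorem beta2_eq_b2_mul_I (D : ℕ) :
    Skeleton.beta2 c' D = (Skeleton.b2 c' D : ℂ) * Complex.I := by
  simp only [Skeleton.beta2, Skeleton.b2]; push_cast; ring

/-- `n^{−ib}` at a prime power: `(q^i)^{−ib} = q^{−i·ib}`. [folklore] -/
private theorem powI_prime_pow (b : ℝ) {q : ℕ} (hq : q ≠ 0) (i : ℕ) :
    MeanSquareMajorant.powI b (q ^ i) = (q : ℂ) ^ (-((i : ℂ) * ((b : ℂ) * Complex.I))) := by
  rw [MeanSquareMajorant.powI_apply_of_ne_zero b (pow_ne_zero i hq), Nat.cast_pow,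
    ← Complex.natCast_cpow_natCast_mul]
  congr 1
  ring

/-- The two-shift convolution `n^{−β₁} ∗ n^{−β₂}` at a prime power `q^m` is the antidiagonal sum
`Σ_{μ₁+μ₂=m} q^{−μ₁β₁−μ₂β₂}`. [folklore] -/
private theorem powI_mul_powI_prime_pow (D : ℕ) {q : ℕ} (hq : q.Prime) (m : ℕ) :
    (MeanSquareMajorant.powI (Skeleton.b1 c' D) * MeanSquareMajorant.powI (Skeleton.b2 c' D)) (q ^ m) =
      ∑ μ ∈ Finset.HasAntidiagonal.antidiagonal m,
        (q : ℂ) ^ (-((μ.1 : ℂ) * Skeleton.beta1 c' D + (μ.2 : ℂ) * Skeleton.beta2 c' D)) := by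
  rw [RankinEisenstein.mul_apply_prime_pow _ _ hq, Finset.Nat.sum_antidiagonal_eq_sum_range_succ_mk]
  refine Finset.sum_congr rfl fun i _ => ?_
  rw [powI_prime_pow _ hq.ne_zero, powI_prime_pow _ hq.ne_zero,
    ← Complex.cpow_add _ _ (Nat.cast_ne_zero.mpr hq.ne_zero), beta1_eq_b1_mul_I, beta2_eq_b2_mul_I]
  congr 1
  ring

/-- **Z22:§A.u022 holds** (kernel-checked): `κ₁(q^r) = Σ_{μ₁+μ₂=r} q^{−μ₁β₁−μ₂β₂} − Σ_{μ₁+μ₂=r−1} q^{−μ₁β₁−μ₂β₂}`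
for `q` prime, `r ≥ 1` — from `κ₁ = n^{−β₁} ∗ n^{−β₂} ∗ μ` and `μ(q^k) = 1, −1, 0`.
[cite: Zhang2022LandauSiegel, App. A p.104] -/
theorem stepA_u022_holds : StepA_u022 c' := by
  intro D q r hq hr
  obtain ⟨k, rfl⟩ : ∃ k, r = k + 1 := ⟨r - 1, by omega⟩
  rw [kappa1, MeanSquareMajorant.kappa₁, RankinEisenstein.mul_apply_prime_pow _ _ hq,
    Finset.sum_range_succ, Finset.sum_range_succ]
  have hzero : ∑ i ∈ Finset.range k,
      (MeanSquareMajorant.powI (Skeleton.b1 c' D) * MeanSquareMajorant.powI (Skeleton.b2 c' D)) (q ^ i) *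
        (ArithmeticFunction.moebius : ArithmeticFunction ℂ) (q ^ (k + 1 - i)) = 0 := by
    refine Finset.sum_eq_zero fun i hi => ?_
    have hi' := Finset.mem_range.mp hi
    have h1 : k + 1 - i ≠ 0 := by omega
    have h2 : k + 1 - i ≠ 1 := by omega
    rw [ArithmeticFunction.intCoe_apply, ArithmeticFunction.moebius_apply_prime_pow hq h1, if_neg h2]
    simp
  rw [hzero, zero_add, powI_mul_powI_prime_pow c' D hq, powI_mul_powI_prime_pow c' D hq,
    ArithmeticFunction.intCoe_apply, ArithmeticFunction.intCoe_apply,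
    show k + 1 - k = 1 by omega, show k + 1 - (k + 1) = 0 by omega, pow_one, pow_zero,
    ArithmeticFunction.moebius_apply_prime hq, ArithmeticFunction.moebius_apply_one,
    show k + 1 - 1 = k by omega]
  push_cast
  ring

/-- `StepA_u022` — `_holds` alias of `stepA_u022_holds` above under the fact's exact name (appended
2026-08-28, D-0026 bookkeeping: the proof term is the existing theorem of this file; no statement,
definition or attribute is edited; no new named fact; the ledger's debt table listed the fact
unproved). [cite: Zhang2022LandauSiegel, App. A p.104] -/
theorem _root_.Literature.NumberTheory.LFunctions.Zhang2022.Typed.AppendixA2.StepA_u022_holds :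
    StepA_u022 c' :=
  _root_.Literature.NumberTheory.LFunctions.Zhang2022.Typed.AppendixA2.stepA_u022_holds (c' := c')

/-- **Z22:§A.u021, first relation, holds** (kernel-checked): `λ̃₁(q^r,1) = λ₁(q)` (`q` prime, `r ≥ 1`).
[cite: Zhang2022LandauSiegel, App. A p.103] -/
theorem stepA_u021a_holds : StepA_u021a c' := by
  intro D χ q r hq hr
  have hr0 : r ≠ 0 := by omega
  simp [lamTilde1, Nat.primeFactors_prime_pow hr0 hq]

/-- `StepA_u021a` — `_holds` alias of `stepA_u021a_holds` above under the fact's exact name (appended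
2026-08-28, D-0026 bookkeeping: the proof term is the existing theorem of this file; no statement,
definition or attribute is edited; no new named fact; the ledger's debt table listed the fact
unproved). [cite: Zhang2022LandauSiegel, App. A p.103] -/
theorem _root_.Literature.NumberTheory.LFunctions.Zhang2022.Typed.AppendixA2.StepA_u021a_holds :
    StepA_u021a c' :=
  _root_.Literature.NumberTheory.LFunctions.Zhang2022.Typed.AppendixA2.stepA_u021a_holds (c' := c')

/-- For a prime `q` and `r ≥ 1`, `𝔫(q^r) = 𝔫(q)`. [folklore] -/
private theorem mem_nset_prime_pow_iff {q r h : ℕ} (hr : 1 ≤ r) :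
    h ∈ Skeleton.nset (q ^ r) ↔ h ∈ Skeleton.nset q := by
  simp only [Skeleton.nset, Set.mem_setOf_eq]
  constructor
  · rintro ⟨h0, hp⟩
    exact ⟨h0, fun p pp hd => pp.dvd_of_dvd_pow (hp p pp hd)⟩
  · rintro ⟨h0, hp⟩
    exact ⟨h0, fun p pp hd => (hp p pp hd).trans (dvd_pow_self q (by omega))⟩

open scoped Classical in
/-- **Z22:§A.u024, first equality, holds** (kernel-checked): `κ̃₁(q^r;1,1) = Σ_{h∈𝔫(q)} κ₁(q^rh)χ(h)/h`.
[cite: Zhang2022LandauSiegel, App. A p.104] -/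
theorem stepA_u024a_holds : StepA_u024a c' := by
  intro D χ q r hq hr
  unfold kappaTilde1
  refine tsum_congr fun h => ?_
  simp only [mem_nset_prime_pow_iff hr, Nat.coprime_one_right_eq_true, and_true, Complex.cpow_one]

/-- `StepA_u024a` — `_holds` alias of `stepA_u024a_holds` above under the fact's exact name (appended
2026-08-28, D-0026 bookkeeping: the proof term is the existing theorem of this file; no statement,
definition or attribute is edited; no new named fact; the ledger's debt table listed the fact
unproved). [cite: Zhang2022LandauSiegel, App. A p.104] -/
theorem _root_.Literature.NumberTheory.LFunctions.Zhang2022.Typed.AppendixA2.StepA_u024a_holds :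
    StepA_u024a c' :=
  _root_.Literature.NumberTheory.LFunctions.Zhang2022.Typed.AppendixA2.stepA_u024a_holds (c' := c')

/-- For a prime `q`: `h ∈ 𝔫(q)` iff `h` is a power of `q`. [folklore] -/
private theorem mem_nset_prime_iff {q h : ℕ} (hq : q.Prime) :
    h ∈ Skeleton.nset q ↔ ∃ k : ℕ, h = q ^ k := by
  simp only [Skeleton.nset, Set.mem_setOf_eq]
  constructor
  · rintro ⟨h0, hp⟩
    exact ⟨_, Nat.eq_prime_pow_of_unique_prime_dvd h0.ne'
      (fun pp hd => (Nat.prime_dvd_prime_iff_eq pp hq).mp (hp _ pp hd))⟩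
  · rintro ⟨k, rfl⟩
    exact ⟨pow_pos hq.pos k, fun p pp hd => pp.dvd_of_dvd_pow hd⟩

open scoped Classical in
/-- **Z22:§A.u024, last equality, holds** (kernel-checked): `Σ_{h∈𝔫(q)} χ(h)/h = 1/(1 − χ(q)q⁻¹)`
(a geometric series over the powers of the prime `q`). [cite: Zhang2022LandauSiegel, App. A p.104] -/
theorem stepA_u024c_holds : StepA_u024c := by
  intro D χ q hq
  have hq0 : (q : ℂ) ≠ 0 := Nat.cast_ne_zero.mpr hq.ne_zero
  -- re-index the sum over `𝔫(q) = {q^k}` by `k`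
  have hinj : Function.Injective (fun k : ℕ => q ^ k) := Nat.pow_right_injective hq.two_le
  have hsupp : Function.support (fun h : ℕ => if h ∈ Skeleton.nset q then χ (h : ZMod D) / (h : ℂ) else 0)
      ⊆ Set.range (fun k : ℕ => q ^ k) := by
    intro h hh
    rw [Function.mem_support] at hh
    by_cases hm : h ∈ Skeleton.nset q
    · obtain ⟨k, rfl⟩ := (mem_nset_prime_iff hq).mp hm
      exact ⟨k, rfl⟩
    · exact absurd (if_neg hm) hh
  rw [← hinj.tsum_eq hsupp]
  have hterm : ∀ k : ℕ, (if q ^ k ∈ Skeleton.nset q then χ ((q ^ k : ℕ) : ZMod D) / ((q ^ k : ℕ) : ℂ) else 0)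
      = (χ (q : ZMod D) / (q : ℂ)) ^ k := by
    intro k
    rw [if_pos ((mem_nset_prime_iff hq).mpr ⟨k, rfl⟩)]
    push_cast
    rw [map_pow, div_pow]
  simp only [hterm]
  have hnorm : ‖χ (q : ZMod D) / (q : ℂ)‖ < 1 := by
    rw [norm_div, Complex.norm_natCast]
    have hq2 : (2 : ℝ) ≤ q := by exact_mod_cast hq.two_le
    calc ‖χ (q : ZMod D)‖ / (q : ℝ) ≤ 1 / q := by
          gcongr; exact DirichletCharacter.norm_le_one χ _
      _ < 1 := by rw [div_lt_one (by linarith)]; linarith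
  rw [tsum_geometric_of_norm_lt_one hnorm, one_div, div_eq_mul_inv]

/-- `1 − q⁻¹ ≠ 0`, `1 + q⁻¹ ≠ 0` in `ℂ` for a prime `q`. [folklore] -/
private theorem one_sub_inv_ne_zero {q : ℕ} (hq : q.Prime) :
    (1 : ℂ) - (q : ℂ)⁻¹ ≠ 0 ∧ (1 : ℂ) + (q : ℂ)⁻¹ ≠ 0 := by
  have hq2 : (2 : ℝ) ≤ q := by exact_mod_cast hq.two_le
  have hn : ‖(q : ℂ)⁻¹‖ < 1 := by
    rw [norm_inv, Complex.norm_natCast]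
    exact inv_lt_one_of_one_lt₀ (by linarith)
  constructor
  · intro h
    have : (q : ℂ)⁻¹ = 1 := by linear_combination -h
    rw [this, norm_one] at hn
    exact lt_irrefl _ hn
  · intro h
    have : (q : ℂ)⁻¹ = -1 := by linear_combination h
    rw [this, norm_neg, norm_one] at hn
    exact lt_irrefl _ hn

/-- **Z22:§A.u028 holds** (kernel-checked): the rational identity
`1/(1−u) − uv(1−vu)/(1−u)² = (1−vu)/(1−u) · (1−vu²)/(1−u²)` for `v = ±1`, `u = q⁻¹`.
[cite: Zhang2022LandauSiegel, App. A p.104] -/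
theorem stepA_u028_holds : StepA_u028 := by
  intro D χ q hq hv
  obtain ⟨h1, h3⟩ := one_sub_inv_ne_zero hq
  have h2 : (1 : ℂ) - (q : ℂ)⁻¹ ^ 2 ≠ 0 := by
    have : (1 : ℂ) - (q : ℂ)⁻¹ ^ 2 = (1 - (q : ℂ)⁻¹) * (1 + (q : ℂ)⁻¹) := by ring
    rw [this]; exact mul_ne_zero h1 h3
  have h1' : (1 - (q : ℂ)⁻¹) ^ 2 ≠ 0 := pow_ne_zero 2 h1
  rw [div_sub_div _ _ h1 h1', div_mul_div_comm, div_eq_div_iff (mul_ne_zero h1 h1') (mul_ne_zero h1 h2)]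
  rcases hv with hv | hv <;> rw [hv] <;> ring

/-- **Z22:§A.u029 holds** (kernel-checked): for `χ(q) = 0` the left side of u028 is `1/(1−q⁻¹)`.
[cite: Zhang2022LandauSiegel, App. A p.104] -/
theorem stepA_u029_holds : StepA_u029 := by
  intro D χ q hq hv
  simp [hv]

end Discharges

/-! ## Part 7. Merge bridges (revision 4): the statements of record unfolded, and the edges from
L4-t8's (A.4)/(A.5) to the readings `EqA4`/`EqA5` — theorems only -/

section Bridges

variable (c' : ℝ)

/-- L4-t3's statement of record of Lemma 15.2 at its instance, `Section15C.Lemma152I c'`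
(= `Lemma152 c' inputs15AB`), unfolds — by `rfl` — to the statement revisions 1–3 of this file carried
locally (`𝓜₁ = Section15B.calM1`); for consumers: `rw [lemma152I_iff]`.
[cite: Zhang2022LandauSiegel, §15 Lemma 15.2 p.87] -/
theorem lemma152I_iff :
    Lemma152I c' ↔
      ∃ C : ℝ, Skeleton.ForAllLarge fun D _ χ => Skeleton.AssumptionA D χ →
        ∀ s : ℂ, ‖s - 1‖ < 5 * Skeleton.alpha D →
          ‖calM1 c' χ 1 1 s - eulerM1 χ‖ ≤ C * (Skeleton.alpha D * Skeleton.ell D) :=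
  Iff.rfl

/-- `Section15C.calU1` at the instance `inputs15AB` is the printed series of `𝒰₁ⱼ` with
`ϖ₁ⱼ = Section15B.varpi1`, by `rfl` (the body revisions 1–3 carried locally).
[cite: Zhang2022LandauSiegel, §15 Lemma 15.3 p.87] -/
theorem calU1_inputs15AB {D : ℕ} [NeZero D] (χ : DirichletCharacter ℂ D) (j : ℕ) (s : ℂ) :
    calU1 c' inputs15AB χ j s =
      (riemannZeta s ^ 2 * χ.LFunction s ^ 2)⁻¹ *
        ∑' n : ℕ, χ (n : ZMod D) * (n.divisors.card : ℂ) * varpi1 c' χ j n / (n : ℂ) ^ s :=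
  rfl

/-- L4-t3's statement of record of Lemma 15.3 (AS PRINTED) at its instance, `Section15C.Lemma153I c'`,
unfolds — by `rfl` — to the statement revisions 1–3 carried locally (first part: a bounded analytic
continuation `U` of `calU1` to `Re s ≥ 9/10`; second part: u053, its value at `1`); for consumers:
`rw [lemma153I_iff]`. [cite: Zhang2022LandauSiegel, §15 Lemma 15.3 p.87] -/
theorem lemma153I_iff :
    Lemma153I c' ↔
      (∃ C : ℝ, Skeleton.ForAllLarge fun D _ χ => Skeleton.AssumptionA D χ →
          ∀ j ∈ ({1, 2, 3} : Finset ℕ), ∃ U : ℂ → ℂ, IsCalU1 c' inputs15AB χ j U ∧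
            ∀ s : ℂ, 9 / 10 ≤ s.re → ‖U s‖ ≤ C) ∧
        ∃ C : ℝ, Skeleton.ForAllLarge fun D _ χ => Skeleton.AssumptionA D χ →
          ∀ j ∈ ({1, 2, 3} : Finset ℕ), ∀ U : ℂ → ℂ, IsCalU1 c' inputs15AB χ j U →
            ‖U 1 - (Nat.totient D : ℂ) ^ 2 / (D : ℂ) ^ 2 * eulerU1 χ‖ ≤
              C * (Skeleton.alpha D * Skeleton.ell D) :=
  Iff.rfl

/-- **Edge: (A.5) of record ⇒ the reading `EqA5`.** L4-t8's `Typed.AppendixA1.EqA_5` (the two cases as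
two implications, over its stubs `xiOne = Section15B.xi1`, `kappaTilde1 = Section15A.kappaTilde1`,
`kappa1 = Section15A.kappa1`, all `rfl`: `AppendixA1.xiOne_eq`, `kappaTilde1_eq`, `kappa1_eq`) gives the
one-equation form, since for `q` prime `¬ (q,l) = 1 ⇒ q ∣ l`. [cite: Zhang2022LandauSiegel, App. A (A.5) p.103] -/
theorem eqA5_of_eqA_5 (h : AppendixA1.EqA_5 c') : EqA5 c' := by
  intro D _ χ q d l r hq hd hl hr
  obtain ⟨h1, h2⟩ := h D χ q d l r hq hd hl hr
  by_cases hql : Nat.Coprime q l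
  · rw [if_pos hql]
    exact h1 hql
  · rw [if_neg hql]
    exact h2 ((Nat.Prime.dvd_iff_not_coprime hq).2 hql)

/-- `Nat.primesBelow D` is the set of primes `q < D` as this file writes it.
[cite: Zhang2022LandauSiegel, App. A (A.4) p.103] -/
theorem primesBelow_eq_filter (D : ℕ) :
    Nat.primesBelow D = (Finset.range D).filter Nat.Prime := by
  ext q
  simp [Nat.mem_primesBelow, Finset.mem_filter, Finset.mem_range]

/-- **Edge: (A.4) of record ⇒ the reading `EqA4`.** `Section15B.calM1 c' χ d l` IS an analytic
continuation of the printed series to `σ > 9/10` — §15.u034: `Section15B.Step15_u034` (the identity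
with `calM1Series` on `σ > 1`) and `Section15B.Step15_u034an` (holomorphy on `σ > 9/10`), while
`AppendixA1.frakm1 = Section15B.calM1Series` by `rfl` (`AppendixA1.frakm1_eq`) — so L4-t8's `EqA_4`
(stated for every such continuation `M`) applies to `M := calM1 c' χ d l`; its finite product is ours
by `primesBelow_eq_filter` and `AppendixA1.factorA4_eq`. Thresholds: the larger of the two `D₀`.
[cite: Zhang2022LandauSiegel, App. A (A.4) p.103; §15 p.84] -/
theorem eqA4_of_eqA_4 (h34 : Section15B.Step15_u034 c') (han : Section15B.Step15_u034an c')
    (h : AppendixA1.EqA_4 c') : EqA4 c' := by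
  obtain ⟨c, hc, C, D₀, hC⟩ := h
  obtain ⟨D₁, hD₁⟩ := han
  refine ⟨c, hc, C, max D₀ D₁, fun D _ χ hD hq hp hA d l s hd hl hdl hcop hs => ?_⟩
  have hdiff : DifferentiableOn ℂ (fun z : ℂ => calM1 c' χ d l z) {z : ℂ | 9 / 10 < z.re} :=
    (hD₁ D χ (le_trans (le_max_right _ _) hD) hq hp hA d l hd hl).2
  have hagree : ∀ z : ℂ, 1 < z.re → (fun z : ℂ => calM1 c' χ d l z) z = AppendixA1.frakm1 c' χ d l z := by
    intro z hz
    rw [AppendixA1.frakm1_eq]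
    exact h34 D χ d l hd hl z hz
  have hM := hC D χ (le_trans (le_max_left _ _) hD) hq hp hA d l hd hl hdl hcop _ hdiff hagree s hs
  rw [Finset.prod_congr (primesBelow_eq_filter D) fun q _ => AppendixA1.factorA4_eq c' χ d l s q] at hM
  exact hM

end Bridges

/-! ## Part 8. Discharges by import (revision 4): (A.5) in the reading `EqA5`, and the deduction
node of Lemma 16.1, whose conclusion sz-d57 proved outright -/

section DischargesByImport

variable (c' : ℝ)

/-- **(A.5) in the reading `EqA5` HOLDS**: L4-t8's `Typed.AppendixA1.eqA_5_holds` (p413628) through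
the edge `eqA5_of_eqA_5`. [cite: Zhang2022LandauSiegel, App. A (A.5) p.103] -/
theorem eqA5_holds : EqA5 c' := eqA5_of_eqA_5 c' (AppendixA1.eqA_5_holds c')

/-- `EqA5` — `_holds` alias of `eqA5_holds` above under the fact's exact name (appended
2026-08-28, D-0026 bookkeeping: the proof term is the existing theorem of this file; no statement,
definition or attribute is edited; no new named fact; the ledger's debt table listed the fact
unproved). [cite: Zhang2022LandauSiegel, App. A (A.5) p.103] -/
theorem _root_.Literature.NumberTheory.LFunctions.Zhang2022.Typed.AppendixA2.EqA5_holds : EqA5 c' :=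
  _root_.Literature.NumberTheory.LFunctions.Zhang2022.Typed.AppendixA2.eqA5_holds (c' := c')

/-- **Z22:Lem16.1.pf HOLDS** — trivially as an implication, because its conclusion `Section16B.Lemma161 c'`
is a theorem of the tree: sz-d57's `AppendixA.lemma161_holds` (p414960; `‖𝔪₂*(s) − 𝔭‖ ≤ C𝓛⁻⁸` for
`|s−1| < 5α`, every character). The displayed steps u033–u038 are not used.
[cite: Zhang2022LandauSiegel, App. A p.105; §16 Lemma 16.1 p.92] -/
theorem lem161_pf_holds : Lem161_pf c' := by
  intro _ _ _ _ _ _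
  exact AppendixA.lemma161_holds c'

/-- `Lem161_pf` — `_holds` alias of `lem161_pf_holds` above under the fact's exact name (appended
2026-08-28, D-0026 bookkeeping: the proof term is the existing theorem of this file; no statement,
definition or attribute is edited; no new named fact; the ledger's debt table listed the fact
unproved). [cite: Zhang2022LandauSiegel, App. A p.105; §16 Lemma 16.1 p.92] -/
theorem _root_.Literature.NumberTheory.LFunctions.Zhang2022.Typed.AppendixA2.Lem161_pf_holds :
    Lem161_pf c' :=
  _root_.Literature.NumberTheory.LFunctions.Zhang2022.Typed.AppendixA2.lem161_pf_holds (c' := c')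

end DischargesByImport

/-! ## Part 9. Repair candidates of GAP row G-L4t3-1 on the Appendix-A side (NOT PRINTED; revision 5)

L4-t3's repair candidate `Section15C.calU1R` replaces the printed normaliser `(ζ(s)²L(s,χ)²)⁻¹` of `𝒰₁ⱼ`
by `(ζ(s)²L(s−βⱼ,χ)²)⁻¹` (decls `calU1R`, `IsCalU1R`, `Step15_u053R`, `Lemma153R`, closed reading
`Lemma153RI`; row G-L4t3-1, Team B "no objection"). Per the cross-read of this file by L4-t8 (STATUS
01:08:22Z) the Appendix-A sketch of Lemma 15.3 is typed here a second time FOR THAT OBJECT, so that the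
discharge lane has kernel targets: the Euler factor `frakU1FactorR`, the Euler product (`StepA_u030R`),
the factor bound "`1 + O(q^{−2σ})` for `(q,D) = 1`" — right for the repaired factor, whose
`q^{−s}`-coefficient `χ(q)τ₂(q)ϖ₁ⱼ(q) − 2 − 2χ(q)q^{βⱼ}` vanishes to first order — (`Lem153_pf_factorBoundR`),
the value at `1` for `q ≤ D`, `(q,D) = 1` (`StepA_u032R`; for `q ∣ D` the two factors coincide,
`frakU1FactorR_eq_of_dvd`, so `StepA_u031` serves both). The deduction twin `Lem153_pfR :
StepA_u030R → Lem153_pf_factorBoundR → StepA_u031 → StepA_u032R → Section15C.Lemma153RpI` (Lemma 15.3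
for the repaired object with a `D`-DEPENDENT bound, the discharge target of record by cell RULING 15e —
for `q ∣ D` the factor is `(1 − q^{−s})²·ϖ₁ⱼ(1)`, so on `σ ≥ 9/10` the product over `q ∣ D` is bounded
only in terms of the prime factors of `D`, `≤ ∏_{q∣D}(1+q^{−9/10})² ≤ exp(2𝓛^{1/10})`; the uniform
`Lemma153RI` is not a discharge target) is a one-line append once L4-t3's `Lemma153RpI` is in the
tree. NOTHING in this Part is a statement of the manuscript. -/

section RepairCandidates

variable (c' : ℝ) {D : ℕ} (χ : DirichletCharacter ℂ D)

/-- **Repair candidate of G-L4t3-1 — the Euler factor of `Section15C.calU1R` at the prime `q`**: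
`(1−q^{−s})²(1−χ(q)q^{−(s−βⱼ)})² Σ_{r≥0} χ(q^r)τ₂(q^r)ϖ₁ⱼ(q^r)q^{−rs}` (cf. `frakU1Factor`, which has
`(1−χ(q)q^{−s})²`). NOT PRINTED. [cite: Zhang2022LandauSiegel, App. A p.105; §15 Lemma 15.3 p.87] -/
def frakU1FactorR (j q : ℕ) (s : ℂ) : ℂ :=
  (1 - (q : ℂ) ^ (-s)) ^ 2 * (1 - χ (q : ZMod D) * (q : ℂ) ^ (-(s - Skeleton.betaJ c' D j))) ^ 2 *
    ∑' r : ℕ, χ ((q ^ r : ℕ) : ZMod D) * (((q ^ r).divisors.card : ℕ) : ℂ) *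
      varpi1 c' χ j (q ^ r) / (q : ℂ) ^ ((r : ℂ) * s)

/-- For a prime `q ∣ D` (`χ(q) = 0`) the repaired and the printed Euler factors coincide, so the
printed u031 (`StepA_u031`) is also the `q ∣ D` input of the repaired deduction.
[cite: Zhang2022LandauSiegel, App. A p.105] -/
theorem frakU1FactorR_eq_of_dvd (j : ℕ) {q : ℕ} (hq : q.Prime) (hqD : q ∣ D) (s : ℂ) :
    frakU1FactorR c' χ j q s = frakU1Factor c' χ j q s := by
  have hχ : χ (q : ZMod D) = 0 := by
    apply χ.map_nonunit
    rw [ZMod.isUnit_iff_coprime]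
    exact (Nat.Prime.dvd_iff_not_coprime hq).1 hqD
  simp only [frakU1FactorR, frakU1Factor, hχ, zero_mul, sub_zero, one_pow]

/-- **Repair candidate of G-L4t3-1 — u030 for the repaired object**: on `σ > 1`,
`Section15C.calU1R = ∏_q frakU1FactorR(q,s)` (at L4-t3's instance `inputs15AB`; `1 ≤ j ≤ 3`). NOT PRINTED.
[cite: Zhang2022LandauSiegel, App. A p.105] -/
def StepA_u030R : Prop :=
  Skeleton.ForAllLarge fun D _ χ => Skeleton.AssumptionA D χ →
    ∀ j ∈ ({1, 2, 3} : Finset ℕ), ∀ s : ℂ, 1 < s.re →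
      Section15C.calU1R c' inputs15AB χ j s = ∏' q : Nat.Primes, frakU1FactorR c' χ j (q : ℕ) s

/-- **Repair candidate of G-L4t3-1 — the in-line factor bound for the repaired factor**:
"`𝔲_{1j}(q,s) = 1 + O(q^{−2σ})` if `(q,D) = 1`" with `frakU1FactorR` for `𝔲_{1j}(q,s)`, `σ ≥ 9/10`
(the claim `Lem153_pf_factorBound` makes for the printed factor, where it is a printed-false candidate).
NOT PRINTED. [cite: Zhang2022LandauSiegel, App. A p.105] -/
def Lem153_pf_factorBoundR : Prop :=
  ∃ C : ℝ, Skeleton.ForAllLarge fun D _ χ => Skeleton.AssumptionA D χ →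
    ∀ j ∈ ({1, 2, 3} : Finset ℕ), ∀ q : ℕ, ∀ s : ℂ, q.Prime → Nat.Coprime q D → 9 / 10 ≤ s.re →
      ‖frakU1FactorR c' χ j q s - 1‖ ≤ C * (q : ℝ) ^ (-(2 * s.re))

/-- **Repair candidate of G-L4t3-1 — u032 for the repaired factor**: for `q ≤ D`, `(q,D) = 1`,
`frakU1FactorR(q,1) = (1−q⁻²)²/(1−χ(q)q⁻²) + O(α₁/q)` (`α₁` read `α𝓛`; the repaired and printed factors
at `s = 1` differ by `((1−χ(q)q^{βⱼ−1})/(1−χ(q)q⁻¹))² = 1 + O(α log q/q)`, inside the stated error).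
NOT PRINTED. [cite: Zhang2022LandauSiegel, App. A p.105] -/
def StepA_u032R : Prop :=
  ∃ C : ℝ, Skeleton.ForAllLarge fun D _ χ => Skeleton.AssumptionA D χ →
    ∀ j ∈ ({1, 2, 3} : Finset ℕ), ∀ q : ℕ, q.Prime → q ≤ D → Nat.Coprime q D →
      ‖frakU1FactorR c' χ j q 1 - (1 - (q : ℂ)⁻¹ ^ 2) ^ 2 / (1 - χ (q : ZMod D) * (q : ℂ)⁻¹ ^ 2)‖ ≤
        C * (Skeleton.alpha D * Skeleton.ell D / q)

/-- **Repair candidate of G-L4t3-1 — the sketch's deduction for the repaired object** ("decl wanted"):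
u030R, the factor bound, the values at `1` (u031 — shared, `frakU1FactorR_eq_of_dvd` — and u032R) ⇒
L4-t3's `Section15C.Lemma153RpI c'` (`Lemma153Rp` at `inputs15AB`: an analytic continuation of `calU1R`
to `Re s ≥ 9/10` with the `D`-DEPENDENT bound `‖U(s)‖ ≤ C·exp(2𝓛^{1/10})`, and its value at `1`) — the
discharge target of record for Lemma 15.3 part 1 (cell RULING 15e, STATUS 2026-08-26T01:35:30Z: the
`q ∣ D` factors are exactly `(1−q^{−s})²`, so "bounded" holds per `D`, not uniformly without an input
on the prime factors of an (A)-modulus that is nowhere in print; the uniform `Lemma153RI` gets no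
Appendix-A twin). NOT PRINTED. [cite: Zhang2022LandauSiegel, App. A p.105; §15 Lemma 15.3 p.87] -/
def Lem153_pfR : Prop :=
  StepA_u030R c' → Lem153_pf_factorBoundR c' → StepA_u031 c' → StepA_u032R c' →
    Section15C.Lemma153RpI c'

end RepairCandidates

end Literature.NumberTheory.LFunctions.Zhang2022.Typed.AppendixA2
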